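import Literature.AlgebraicGeometry.AbelianSchemes.IsLambdaOfAtSquareRoot
import Literature.AlgebraicGeometry.AbelianSchemes.IsLambdaOfAtOntoOfAmpleWitness
import Literature.AlgebraicGeometry.AbelianSchemes.AbelianSchemeOverHomNoetherianAnyBase
import Literature.AlgebraicGeometry.AbelianSchemes.AbelianSchemeQuotientMulNDescent
import Literature.AlgebraicGeometry.AbelianSchemes.IsLambdaOfAtSquareRootOfTwoNeZero
import HarnessLib

/-!
# The root of `λ̄²` at a geometric point: from `λ̄² = Λ(𝒪(Θ₂))` with `Θ₂` AMPLE to `λ̄ = Λ(𝒪(Θ₁))` with `Θ₁` ample —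
# the binders of the (V)-upgrade discharged (Mumford AV §23 Thm. 3, §8 Thm. 1; MFK Def. 6.3; GW II Prop. 27.284)

Layer `Literature/AlgebraicGeometry/AbelianSchemes`, namespace `Literature.AlgebraicGeometry.AbelianSchemes.AbelianSchemeOver`.
THEOREMS ONLY (no definition, no named fact, no instance, no notation, no `sorry`).  Cell `hodgecm-mathlib` (D-0151), P6 «MOD programme», road
(C1) «Θ-SPREAD» (LEAD F0P6-plan (g2) RULING «M-28′» 22:52:19Z and HANDS RE-CUT 22:56:58Z (b) **«`hroot` ASSEMBLY»**; B-p18 (g38) corrected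
census 22:56:44Z; prover seat B-p02 (g22)).

THE SITUATION at a geometric point `z̄ : Spec Ω → S` of the `[2]⁻¹`-stage: B-p18's O3′ delivers `hsq : IsLambdaOfAt z̄ D (λ ^ 2) Θ₂` with `Θ₂`
AMPLE (the divisor of `L^Δ(λ)|_{A_z̄}`), and the root `λ̄ = Λ(𝒪(Θ₁))`, `Θ₁` ample — i.e. «`λ` is a POLARIZATION at `z̄`» ([MumfordFogartyKirwan1994]
Def. 6.3) — is ★ G4 `exists_isAmple_isLambdaOfAt_of_sq` in characteristic `0` and B-p08 (g33)'s O5 «HALF-`p`» head (the same with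
`[CharZero Ω] ↦ (2 : Ω) ≠ 0`) otherwise.  Both take the SAME two side binders, which this file DISCHARGES from `hsq` + `Θ₂` ample + `dim Â_z̄ = dim A_z̄`:

* §1 **`IsLambdaOfAt.exists_comp_sq_eq_of_isAmple`** — `hsurj2`: `λ̄²` is ONTO on `Ω`-points (`λ·λ` is a homomorphism over a locally Noetherian
  base ★ `isCommMonObj_of_isLocallyNoetherian_base` + ★ `isMonHom_mul`; an ample witness makes it an isogeny in equal dimensions, hence onto ★
  `IsLambdaOfAt.exists_comp_eq_of_isAmple_of_dim_eq`; `λ ^ 2 = λ·λ`);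
* §2 **`IsAmple.exists_odd_isSection_ne_zero`** — the ODD AMPLE SECTION: an ample divisor has a non-zero section of some ODD multiple (★
  `IsAmple.exists_forall_le_isSection_ne_zero`: all large multiples; take `2n₀ + 1`);
* §3 **`exists_isAmple_isLambdaOfAt_of_isLambdaOfAt_sq`** — HEAD, characteristic `0`: `hsq` + `Θ₂` ample + `hdim` ⇒ `∃ Θ₁` ample with
  `IsLambdaOfAt z̄ D λ Θ₁` (★ G4 by name with §1 + §2);
* §4 **`exists_isAmple_isLambdaOfAt_of_isLambdaOfAt_sq_of_half`** — HEAD, any characteristic, MODULO THE HALVING: the same conclusion from an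
  explicit halving hypothesis `half` of the exact shape of ★ G4 §4 ∕ O5 (so that the consumer case-splits `ringChar Ω` and feeds ★ G4 or O5's
  head BY NAME into `half`; when O5 «HALF-`p`» lands, ED. 2 adds the `(2 : Ω) ≠ 0` head by name).
* §5 (ED. 2) **`exists_isAmple_isLambdaOfAt_of_isLambdaOfAt_sq_of_two_ne_zero`** — HEAD, characteristic `≠ 2` BY NAME: `(2 : Ω) ≠ 0` + `hsq` +
  `Θ₂` ample + `hdim` ⇒ `∃ Θ₁` ample with `IsLambdaOfAt z̄ D λ Θ₁` — §4's socket fed with ★ O5 «HALF-`p`» (B-p18 (g38))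
  `exists_isLambdaOfAt_isAmple_of_sq_of_two_ne_zero` (its conclusion `IsLambdaOfAt ∧ IsAmple` flipped back to `IsAmple ∧ IsLambdaOfAt`).

HC_CM is proved only modulo the printed citations (2 remaining named inputs hLiu418, h413) until rung 0 closes; this file asserts nothing about HC
and is count-neutral ★ capital.

## References
* [MumfordAV1970] D. Mumford, *Abelian Varieties* (1970), §23 Thm. 3 (p. 231), §8 Thm. 1 (p. 77), §6 Application 1 (p. 60).
* [MumfordFogartyKirwan1994] D. Mumford, J. Fogarty, F. Kirwan, *GIT*, 3rd ed. (1994), Ch. 6 §2 Def. 6.3 (p. 120), §1 Cor. 6.5 (p. 117).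
* [GortzWedhorn2023] U. Görtz, T. Wedhorn, *Algebraic Geometry II* (2023), Prop. 27.284, Prop. 27.176 and Cor. 27.177.
* [GortzWedhorn2020] U. Görtz, T. Wedhorn, *Algebraic Geometry I*, 2nd ed. (2020), Prop. 13.47 and Def. 13.44 (p. 494) (ample ⇒ sections of
  large multiples).
-/

noncomputable section

-- `TopCat.Presheaf`/`Scheme.Modules` are not reducible (as in ★ `IsLambdaOfAtSquareRoot`).
set_option backward.isDefEq.respectTransparency false

open CategoryTheory CategoryTheory.Limits AlgebraicGeometry MonoidalCategory CartesianMonoidalCategory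
open scoped MonObj

universe u

namespace Literature.AlgebraicGeometry.AbelianSchemes

open Literature.AlgebraicGeometry.Motives Literature.AlgebraicGeometry.AbelianVarieties

namespace AbelianSchemeOver

variable {S : Scheme.{u}} (A : AbelianSchemeOver S) (D : A.DualPair) {Ω : Type u} [Field Ω] [IsAlgClosed Ω]
  (s : Spec (.of Ω) ⟶ S) {lam : A.X ⟶ D.hat.X} [IsMonHom lam]

/-! ## §1 `hsurj2`: `λ̄²` is onto on `Ω`-points -/

/-- **`λ̄²` IS ONTO ON `Ω`-POINTS** when `λ̄² = Λ(𝒪(Θ₂))` at `s` with `Θ₂` ample and `dim Â_s = dim A_s` (the `hsurj2` binder of ★ G4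
`exists_isAmple_isLambdaOfAt_of_sq` ∕ O5): over a locally Noetherian base `Â` is commutative (★ `isCommMonObj_of_isLocallyNoetherian_base`), so
`λ·λ` is a homomorphism (★ `isMonHom_mul`) with an ample witness, hence an isogeny onto on points (★
`IsLambdaOfAt.exists_comp_eq_of_isAmple_of_dim_eq`); `λ ^ 2 = λ·λ`. [cite: MumfordAV1970, §8 Thm. 1 (p. 77)]
[cite: MumfordFogartyKirwan1994, Ch. 6 §2 Definition 6.3 (p. 120) and §1 Corollary 6.5 (p. 117)] [cite: GortzWedhorn2023, Prop. 27.176 and Cor. 27.177] -/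
theorem IsLambdaOfAt.exists_comp_sq_eq_of_isAmple [IsLocallyNoetherian S] {Θ₂ : CartierDivisor (A.fibre s).toAbelianVariety.X.left}
    (hsq : A.IsLambdaOfAt s D (lam ^ 2) Θ₂) (hamp₂ : Θ₂.IsAmple)
    (hdim : (A.fibre s).toAbelianVariety.dim = (D.hat.fibre s).toAbelianVariety.dim) (y : D.hat.FibrePoints s) :
    ∃ x : A.FibrePoints s, x ≫ (lam ^ 2) = y := by
  haveI : IsCommMonObj D.hat.X := D.hat.isCommMonObj_of_isLocallyNoetherian_base
  haveI : IsMonHom (lam * lam) := D.hat.isMonHom_mul lam lam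
  have hsq' : A.IsLambdaOfAt s D (lam * lam) Θ₂ := by rw [← pow_two]; exact hsq
  obtain ⟨x, hx⟩ := hsq'.exists_comp_eq_of_isAmple_of_dim_eq A D s hamp₂ hdim y
  exact ⟨x, by rw [pow_two]; exact hx⟩

/-! ## §2 The odd ample section -/

omit [IsAlgClosed Ω] [IsMonHom lam] in
/-- **An ample divisor has a non-zero section of some ODD multiple** (`N = 2n₀ + 1`, ★ `IsAmple.exists_forall_le_isSection_ne_zero`: `Γ(𝒪(N•Θ)) ≠ 0`
for all `N ≥ n₀`) — the «odd ample section» binder of ★ G4 ∕ O5. [cite: GortzWedhorn2020, Prop. 13.47 and Def. 13.44 (p. 494)]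
[cite: MumfordAV1970, §23 Thm. 3 (p. 231)] -/
theorem IsAmple.exists_odd_isSection_ne_zero {X : Scheme.{u}} [IsIntegral X] {Θ : CartierDivisor X} (hΘ : Θ.IsAmple) :
    ∃ N : ℕ, Odd N ∧ ∃ s₀ : X.functionField, s₀ ≠ 0 ∧ (N • Θ).IsSection s₀ := by
  obtain ⟨n₀, h⟩ := hΘ.exists_forall_le_isSection_ne_zero
  obtain ⟨s₀, hs, hs0⟩ := h (2 * n₀ + 1) (by omega)
  exact ⟨2 * n₀ + 1, ⟨n₀, rfl⟩, s₀, hs0, hs⟩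

/-! ## §3 HEAD in characteristic `0` -/

/-- **THE ROOT OF `λ̄²` AT A GEOMETRIC POINT OF CHARACTERISTIC `0`** («`hroot` ASSEMBLY»): over a locally Noetherian base, if `λ̄² = Λ(𝒪(Θ₂))` at the
geometric point `s` (`Ω` algebraically closed of characteristic `0`) with `Θ₂` AMPLE and `dim Â_s = dim A_s`, then `λ̄ = Λ(𝒪(Θ₁))` for an AMPLE
`Θ₁` — `λ` is a polarization at `s` ([MumfordFogartyKirwan1994] Def. 6.3).  ★ G4 `exists_isAmple_isLambdaOfAt_of_sq` with its two binders
discharged by §1 (`hsurj2`) and §2 (odd ample section). [cite: MumfordAV1970, §23 Thm. 3 (p. 231)] [cite: MumfordFogartyKirwan1994, Ch. 6 §2 Definition 6.3 (p. 120)]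
[cite: GortzWedhorn2023, Prop. 27.284] -/
theorem exists_isAmple_isLambdaOfAt_of_isLambdaOfAt_sq [IsLocallyNoetherian S] [CharZero Ω]
    {Θ₂ : CartierDivisor (A.fibre s).toAbelianVariety.X.left} (hsq : A.IsLambdaOfAt s D (lam ^ 2) Θ₂) (hamp₂ : Θ₂.IsAmple)
    (hdim : (A.fibre s).toAbelianVariety.dim = (D.hat.fibre s).toAbelianVariety.dim) :
    ∃ Θ₁ : CartierDivisor (A.fibre s).toAbelianVariety.X.left, Θ₁.IsAmple ∧ A.IsLambdaOfAt s D lam Θ₁ := by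
  obtain ⟨N, hN, s₀, hs₀, hsec⟩ := IsAmple.exists_odd_isSection_ne_zero hamp₂
  exact A.exists_isAmple_isLambdaOfAt_of_sq D s (IsLambdaOfAt.exists_comp_sq_eq_of_isAmple A D s hsq hamp₂ hdim) hamp₂ hN hs₀ hsec hsq

/-! ## §4 HEAD in any characteristic, modulo the halving -/

omit [IsAlgClosed Ω] in
/-- **THE ROOT OF `λ̄²` AT A GEOMETRIC POINT, MODULO THE HALVING** («`hroot` ASSEMBLY», socket form): if the halving statement `half` — the
exact shape of ★ G4 §4 `exists_isAmple_isLambdaOfAt_of_sq` (characteristic `0`) ∕ O5 «HALF-`p`» (`(2 : Ω) ≠ 0`): from `hsurj2`, an ample `Θ` with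
a non-zero section of an odd multiple and `λ̄² = Λ(𝒪(Θ))`, an ample root `Θ₁` — holds for `(A, D, s, λ)`, then `λ̄² = Λ(𝒪(Θ₂))` with `Θ₂`
ample and `dim Â_s = dim A_s` give an ample `Θ₁` with `λ̄ = Λ(𝒪(Θ₁))` (§1 + §2 feed `half`).  The consumer case-splits `ringChar Ω` and
instantiates `half` BY NAME. [cite: MumfordAV1970, §23 Thm. 3 (p. 231)] [cite: MumfordFogartyKirwan1994, Ch. 6 §2 Definition 6.3 (p. 120)] -/
theorem exists_isAmple_isLambdaOfAt_of_isLambdaOfAt_sq_of_half [IsLocallyNoetherian S] [IsAlgClosed Ω]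
    (half : ∀ ⦃Θ : CartierDivisor (A.fibre s).toAbelianVariety.X.left⦄, Θ.IsAmple →
      ∀ ⦃N : ℕ⦄, Odd N → ∀ ⦃s₀ : (A.fibre s).toAbelianVariety.X.left.functionField⦄, s₀ ≠ 0 → (N • Θ).IsSection s₀ →
        A.IsLambdaOfAt s D (lam ^ 2) Θ → (∀ y : D.hat.FibrePoints s, ∃ x : A.FibrePoints s, x ≫ (lam ^ 2) = y) →
          ∃ Θ₁ : CartierDivisor (A.fibre s).toAbelianVariety.X.left, Θ₁.IsAmple ∧ A.IsLambdaOfAt s D lam Θ₁)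
    {Θ₂ : CartierDivisor (A.fibre s).toAbelianVariety.X.left} (hsq : A.IsLambdaOfAt s D (lam ^ 2) Θ₂) (hamp₂ : Θ₂.IsAmple)
    (hdim : (A.fibre s).toAbelianVariety.dim = (D.hat.fibre s).toAbelianVariety.dim) :
    ∃ Θ₁ : CartierDivisor (A.fibre s).toAbelianVariety.X.left, Θ₁.IsAmple ∧ A.IsLambdaOfAt s D lam Θ₁ := by
  obtain ⟨N, hN, s₀, hs₀, hsec⟩ := IsAmple.exists_odd_isSection_ne_zero hamp₂
  exact half hamp₂ hN hs₀ hsec hsq (IsLambdaOfAt.exists_comp_sq_eq_of_isAmple A D s hsq hamp₂ hdim)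

/-! ## §5 HEAD in characteristic `≠ 2` (ED. 2: O5 «HALF-`p`» by name) -/

/-- **THE ROOT OF `λ̄²` AT A GEOMETRIC POINT OF CHARACTERISTIC `≠ 2`** («`hroot` ASSEMBLY», ED. 2): over a locally Noetherian base, if
`λ̄² = Λ(𝒪(Θ₂))` at the geometric point `s` (`Ω` algebraically closed with `(2 : Ω) ≠ 0`) with `Θ₂` AMPLE and `dim Â_s = dim A_s`, then
`λ̄ = Λ(𝒪(Θ₁))` for an AMPLE `Θ₁` — `λ` is a polarization at `s` ([MumfordFogartyKirwan1994] Def. 6.3).  The §4 socket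
`exists_isAmple_isLambdaOfAt_of_isLambdaOfAt_sq_of_half` with `half` := ★ O5 «HALF-`p`» `exists_isLambdaOfAt_isAmple_of_sq_of_two_ne_zero`
([MumfordAV1970] §23 Thm. 3 at `n = 2` for the Néron–Severi half), conjuncts flipped; §1 (`hsurj2`) and §2 (odd ample section) feed it.
[cite: MumfordAV1970, §23 Thm. 3 (p. 231)] [cite: MumfordFogartyKirwan1994, Ch. 6 §2 Definition 6.3 (p. 120)]
[cite: GortzWedhorn2023, Prop. 27.284] -/
theorem exists_isAmple_isLambdaOfAt_of_isLambdaOfAt_sq_of_two_ne_zero [IsLocallyNoetherian S] (h2 : (2 : Ω) ≠ 0)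
    {Θ₂ : CartierDivisor (A.fibre s).toAbelianVariety.X.left} (hsq : A.IsLambdaOfAt s D (lam ^ 2) Θ₂) (hamp₂ : Θ₂.IsAmple)
    (hdim : (A.fibre s).toAbelianVariety.dim = (D.hat.fibre s).toAbelianVariety.dim) :
    ∃ Θ₁ : CartierDivisor (A.fibre s).toAbelianVariety.X.left, Θ₁.IsAmple ∧ A.IsLambdaOfAt s D lam Θ₁ :=
  exists_isAmple_isLambdaOfAt_of_isLambdaOfAt_sq_of_half A D s
    (fun _ hamp _ hN _ hs₀ hsec h hsurj2 =>
      let ⟨Θ₁, h₁, h₁'⟩ := A.exists_isLambdaOfAt_isAmple_of_sq_of_two_ne_zero D s h2 hsurj2 hamp hN hs₀ hsec h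
      ⟨Θ₁, h₁', h₁⟩)
    hsq hamp₂ hdim

end AbelianSchemeOver

end Literature.AlgebraicGeometry.AbelianSchemes

end
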